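import Mathlib
import Literature.Geometry.Symplectic.JNormalPushoff
import Literature.Geometry.Symplectic.JNormalPushoffEquation
import Literature.Geometry.Symplectic.JRotationBranchSolve
import Literature.Geometry.Symplectic.JRotationBranchRegularity
import Literature.Geometry.Symplectic.JRotationBranchDerivative
import Literature.Geometry.Symplectic.JRotationBranchChartEstimates
import Literature.Geometry.Symplectic.JTransverseProjector
import Literature.Analysis.Complex.CauchyPompeiu
import HarnessLib

/-!
# The Cauchy–Riemann inequality for the normal coordinate of the rotated branch (Wendl 2020, App. B, §B.2.5)

Flat model, dimension four, in the setting of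
`Literature.Geometry.Symplectic.BranchNormalForm.exists_adaptedNormalForm` (smooth chart `Θ`,
`C¹` chart `ξ` with `ξ z₀ = 0`, `Dξ(z₀) = 𝟙`, normal form `Θ (u z) = ((ξ z)ᵏ, û (ξ z))`,
transported structure `J₂` with `J₂ 0 = i`, standard on normal vectors along the axis). For a
`k`-th root of unity `ε̄` let `sol s = (θ(s), η(s))` be the rotated branch of
`Literature/Geometry/Symplectic/JRotationBranchSolve.lean` for the normal frame
`X = NormalPushoff.frame J₂` (Wendl's (B.20)). **`dbar_normalCoordinate`**: in the ORIGINAL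
variable `ζ = z - z₀` the normal coordinate `f ζ = η (ξ (z₀ + ζ))` is `C¹` on a punctured disc,
satisfies `‖f ζ‖ ≤ C' |ζ|^{k+1}`, has bounded derivative, and obeys the linear Cauchy–Riemann
inequality `‖∂̄ f‖ ≤ M ‖f‖` there — exactly the hypotheses of the punctured similarity principle
`Literature.Analysis.Complex.similarity_dichotomy_punctured'` (Wendl 2020, §B.2.5: "`η` satisfies
a linear Cauchy–Riemann type equation, so the similarity principle applies").

The inequality is `Literature.Geometry.Symplectic.NormalPushoff.norm_dbar_le_of_pushoff`
(Prop. B.28) applied to the `J₂`-holomorphic curve `g = Θ ∘ u`, the reparametrisation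
`φ̃ = ξ⁻¹ ∘ θ ∘ ξ` and `η̃ = η ∘ ξ` (the fixed-point equations ARE the push-off identity
`g = g ∘ φ̃ + X(g ∘ φ̃) η̃`, `RotationBranch.pushoff_identity`), with the projector of
`Literature/Geometry/Symplectic/JTransverseProjector.lean`, whose norm stays `≤ 5` near the
critical point because the tangent direction stays near `e₁` (`RotationBranch.tangent_direction`)
and `J₂` stays near `i`; all remaining factors are bounded by
`RotationBranch.structure_local_bounds`, `RotationBranch.xi_local_bounds`,
`RotationBranch.xi_symm_local_bounds` and `RotationBranch.exists_norm_fderiv_sol_le`. The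
variable must be the original `z`: `ξ` is not holomorphic, so the inequality does not survive
passage to the chart variable `s`.

Everything is proved; no named facts.

## References

* C. Wendl, *Lectures on Contact 3-Manifolds, Holomorphic Curves and Intersection Theory*,
  Cambridge Tracts in Math. 220 (2020), App. B, Prop. B.28, Thm B.23, Lemma B.35, §B.2.5. [Wendl2020]
* M. Micallef, B. White, *The structure of branch points in minimal surfaces and in
  pseudoholomorphic curves*, Ann. of Math. 141 (1995), §6. [MicallefWhite1995]
-/

noncomputable section

open scoped Topology ContDiff
open Set Filter Metric Complex
open Literature.Analysis.Complex Literature.Geometry.Symplectic.TransverseProjector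

namespace Literature.Geometry.Symplectic.RotationBranch

set_option maxHeartbeats 1600000 in
/-- **The normal coordinate of the rotated branch satisfies the punctured similarity
hypotheses** (see the module docstring). Hypotheses: the conclusions of
`BranchNormalForm.exists_adaptedNormalForm` that are used, smoothness of `u` on `B(z₀,ρ)`, and a
`k`-th root of unity `ε̄`. Conclusion: for `f ζ = (sol (ξ (z₀ + ζ))).2` with
`sol = RotationBranch.sol k ε̄ û (NormalPushoff.frame J₂) (2C+1)`, on some punctured disc
`0 < |ζ| < R'`: `f ∈ C¹`, `‖f ζ‖ ≤ C' |ζ|^{k+1}`, `‖Df ζ‖ ≤ B'`, `‖∂̄ f ζ‖ ≤ M ‖f ζ‖`.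
[cite: Wendl2020, App. B, Prop. B.28, Lemma B.35 and §B.2.5] -/
theorem dbar_normalCoordinate {F : Type*} [NormedAddCommGroup F] [NormedSpace ℝ F]
    {Θ : OpenPartialHomeomorph F (ℂ × ℂ)} {J₂ : ℂ × ℂ → ℂ × ℂ →L[ℝ] ℂ × ℂ}
    {ξ : OpenPartialHomeomorph ℂ ℂ} {uhat : ℂ → ℂ} {u : ℂ → F} {z₀ : ℂ} {k : ℕ}
    {r C ρ ρ₁ : ℝ} {εb : ℂ}
    (hk : 0 < k) (hr : 0 < r) (hρ : 0 < ρ) (hρ₁ : 0 < ρ₁) (hC : 0 ≤ C)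
    (hε : εb ^ k = 1) (hεn : ‖εb‖ = 1)
    (hu : ContDiffOn ℝ ∞ u (ball z₀ ρ))
    (hpsrc : u z₀ ∈ Θ.source) (hΘp : Θ (u z₀) = 0) (hΘsmooth : ContDiffOn ℝ ∞ Θ Θ.source)
    (hJ₂smooth : ContDiffOn ℝ ∞ J₂ Θ.target)
    (hJ₂2 : ∀ y ∈ Θ.target, ∀ v, J₂ y (J₂ y v) = -v) (hJ₂0 : ∀ v, J₂ 0 v = I • v)
    (haxis : ∀ q : ℂ, ‖q‖ < r → ((q, (0 : ℂ)) : ℂ × ℂ) ∈ Θ.target ∧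
      ∀ w : ℂ, J₂ (q, 0) (0, w) = (0, I * w))
    (husrc : MapsTo u (ball z₀ ρ) Θ.source)
    (hghol : ∀ z ∈ ball z₀ ρ, fderiv ℝ (Θ ∘ u) z I = J₂ (Θ (u z)) (fderiv ℝ (Θ ∘ u) z 1))
    (hb2 : ∀ z ∈ ball (0 : ℂ) ρ,
      ‖fderiv ℝ (fun z => Θ (u (z₀ + z)) - z ^ k • ((1 : ℂ), (0 : ℂ))) z‖ ≤ C * ‖z‖ ^ k)
    (hsrc : ball z₀ ρ ⊆ ξ.source) (htgt : ball (0 : ℂ) ρ₁ ⊆ ξ.target) (hξ0 : ξ z₀ = 0)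
    (hfd0 : fderiv ℝ ξ z₀ = ContinuousLinearMap.id ℝ ℂ)
    (hξC1 : ContDiffOn ℝ 1 ξ ξ.source) (hξsymmC1 : ContDiffOn ℝ 1 ξ.symm ξ.target)
    (hξsmooth : ContDiffOn ℝ ∞ ξ (ξ.source \ {z₀}))
    (huhatC1 : ContDiffOn ℝ 1 uhat (ball 0 ρ₁))
    (huhat1 : ∀ w ∈ ball (0 : ℂ) ρ₁, ‖uhat w‖ ≤ C * ‖w‖ ^ (k + 1))
    (huhat2 : ∀ w ∈ ball (0 : ℂ) ρ₁, ‖fderiv ℝ uhat w‖ ≤ C * ‖w‖ ^ k)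
    (hnf : ∀ z ∈ ball z₀ ρ, Θ (u z) = ((ξ z) ^ k, uhat (ξ z))) :
    ∃ (R' C' B' M : ℝ), 0 < R' ∧
      ContDiffOn ℝ 1
        (fun ζ => (sol k εb uhat (NormalPushoff.frame J₂) (2 * C + 1) (ξ (z₀ + ζ))).2)
        (ball 0 R' \ {0}) ∧
      (∀ ζ ∈ ball (0 : ℂ) R' \ {0},
        ‖(sol k εb uhat (NormalPushoff.frame J₂) (2 * C + 1) (ξ (z₀ + ζ))).2‖ ≤
          C' * ‖ζ‖ ^ (k + 1)) ∧
      (∀ ζ ∈ ball (0 : ℂ) R' \ {0},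
        ‖fderiv ℝ (fun ζ => (sol k εb uhat (NormalPushoff.frame J₂) (2 * C + 1) (ξ (z₀ + ζ))).2)
          ζ‖ ≤ B') ∧
      (∀ ζ ∈ ball (0 : ℂ) R' \ {0},
        ‖dbarAlong 1
            (fun ζ => (sol k εb uhat (NormalPushoff.frame J₂) (2 * C + 1) (ξ (z₀ + ζ))).2) ζ‖ ≤
          M * ‖(sol k εb uhat (NormalPushoff.frame J₂) (2 * C + 1) (ξ (z₀ + ζ))).2‖) := by
  have hk' : k ≠ 0 := Nat.pos_iff_ne_zero.1 hk
  set X : ℂ × ℂ → ℂ →L[ℝ] ℂ × ℂ := NormalPushoff.frame J₂ with hX_def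
  set b : ℝ := 2 * C + 1 with hb_def
  set SOL : ℂ → ℂ × ℂ := sol k εb uhat X b with hSOL
  set e₁ : ℂ × ℂ := (((1 : ℂ), (0 : ℂ)) : ℂ × ℂ) with he₁
  have hz₀src : z₀ ∈ ξ.source := hsrc (mem_ball_self hρ)
  have h0tgt : (0 : ℂ × ℂ) ∈ Θ.target := hΘp ▸ Θ.map_source hpsrc
  -- ### constants: structure, frame, branch, charts
  obtain ⟨δ, K, L₁, hδ, hK0, hL₁0, hδV, hnear, hJn, hLip, hXn, hDX⟩ :=
    structure_local_bounds Θ.open_target h0tgt hJ₂smooth hJ₂0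
  have haxis' : ∀ q : ℂ, ‖q‖ < r → ((q, (0 : ℂ)) : ℂ × ℂ) ∈ Θ.target ∧
      J₂ (q, 0) (0, 1) = (0, I) := fun q hq =>
    ⟨(haxis q hq).1, by simpa using (haxis q hq).2 1⟩
  obtain ⟨CX, δX, hCX, hδX, -, hδXV, hX1, -, hX2⟩ :=
    NormalPushoff.exists_frame_estimates (Jt := J₂) Θ.open_target h0tgt hJ₂smooth hr haxis'
  have hXc : ContDiffOn ℝ 1 X Θ.target :=
    (NormalPushoff.contDiffOn_frame hJ₂smooth).of_le (by norm_cast)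
  obtain ⟨ε₁, hε₁, hreg⟩ := exists_regular_branch (k := k) (εb := εb) (uh := uhat) (X := X) hk' hε hεn
    hC hCX hρ₁ hδX Θ.open_target hδXV hXc huhatC1 huhat1 huhat2 hX1 hX2
  obtain ⟨ε₂, B, hε₂, hB0, hder⟩ := exists_norm_fderiv_sol_le (k := k) (εb := εb) (uh := uhat)
    (X := X) hk' hε hεn hC hCX hρ₁ hδX Θ.open_target hδXV hXc huhatC1 huhat1 huhat2 hX1 hX2
  obtain ⟨r₁, hr₁, hr₁ρ, hξD, hξb, hξne⟩ := xi_local_bounds ξ hρ hsrc hξ0 hξC1 hfd0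
  obtain ⟨r₂, hr₂, hr₂ρ₁, hsD, hsb, hsball⟩ :=
    xi_symm_local_bounds ξ hρ₁ (half_pos hρ) hz₀src htgt hξ0 hξC1 hξsymmC1 hfd0
  -- ### the chart curve `g = Θ ∘ u` and a bound for its derivative on the half ball
  have hg : ContDiffOn ℝ ∞ (Θ ∘ u) (ball z₀ ρ) := hΘsmooth.comp hu husrc
  have hg1 : ContDiffOn ℝ 1 (Θ ∘ u) (ball z₀ ρ) := hg.of_le (by norm_cast)
  have hgd : ∀ z ∈ ball z₀ ρ, DifferentiableAt ℝ (Θ ∘ u) z := fun z hz =>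
    (hg1.differentiableOn one_ne_zero).differentiableAt (isOpen_ball.mem_nhds hz)
  have hDg : ContinuousOn (fderiv ℝ (Θ ∘ u)) (ball z₀ ρ) :=
    hg1.continuousOn_fderiv_of_isOpen isOpen_ball le_rfl
  obtain ⟨A₀, hA₀⟩ := (isCompact_closedBall z₀ (ρ / 2)).exists_bound_of_continuousOn
    (f := fderiv ℝ (Θ ∘ u)) (hDg.mono (closedBall_subset_ball (by linarith)))
  have hA₀0 : 0 ≤ A₀ := (norm_nonneg _).trans (hA₀ z₀ (mem_closedBall_self (by positivity)))
  -- ### the radius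
  set R' : ℝ := min (min (min r₁ (ρ / 16)) (min (min ε₁ ε₂ / 2) (r₂ / 4)))
    (min (min (1 / 4) (k / (1024 * (C + 1)))) (δ / (4 * (1 + C)))) with hR'
  have hR'pos : 0 < R' := by
    simp only [hR', lt_min_iff]
    refine ⟨⟨⟨hr₁, by positivity⟩, ⟨by positivity, by positivity⟩⟩, ⟨⟨by norm_num, ?_⟩, by positivity⟩⟩
    have : (0 : ℝ) < k := by exact_mod_cast hk
    positivity
  have hR'r₁ : R' ≤ r₁ := by simp only [hR']; exact (min_le_left _ _).trans ((min_le_left _ _).trans (min_le_left _ _))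
  have hR'ρ : R' ≤ ρ / 16 := by simp only [hR']; exact (min_le_left _ _).trans ((min_le_left _ _).trans (min_le_right _ _))
  have hR'ε : R' ≤ min ε₁ ε₂ / 2 := by simp only [hR']; exact (min_le_left _ _).trans ((min_le_right _ _).trans (min_le_left _ _))
  have hR'r₂ : R' ≤ r₂ / 4 := by simp only [hR']; exact (min_le_left _ _).trans ((min_le_right _ _).trans (min_le_right _ _))
  have hR'1 : R' ≤ 1 / 4 := by simp only [hR']; exact (min_le_right _ _).trans ((min_le_left _ _).trans (min_le_left _ _))
  have hR'k : R' ≤ k / (1024 * (C + 1)) := by simp only [hR']; exact (min_le_right _ _).trans ((min_le_left _ _).trans (min_le_right _ _))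
  have hR'δ : R' ≤ δ / (4 * (1 + C)) := by simp only [hR']; exact (min_le_right _ _).trans (min_le_right _ _)
  -- ### size of points on the curve
  have hptbound : ∀ w ∈ ball (0 : ℂ) ρ₁, ‖w‖ ≤ 1 → ‖pt k uhat w‖ ≤ (1 + C) * ‖w‖ := by
    intro w hw hw1
    rw [pt, Prod.norm_mk, max_le_iff, norm_pow]
    have hwk : ‖w‖ ^ k ≤ ‖w‖ := by
      calc ‖w‖ ^ k ≤ ‖w‖ ^ 1 := pow_le_pow_of_le_one (norm_nonneg _) hw1 hk
        _ = ‖w‖ := pow_one _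
    have hwk1 : ‖w‖ ^ (k + 1) ≤ ‖w‖ := by
      calc ‖w‖ ^ (k + 1) ≤ ‖w‖ ^ 1 := pow_le_pow_of_le_one (norm_nonneg _) hw1 (by omega)
        _ = ‖w‖ := pow_one _
    constructor
    · nlinarith [norm_nonneg w]
    · calc ‖uhat w‖ ≤ C * ‖w‖ ^ (k + 1) := huhat1 w hw
        _ ≤ C * ‖w‖ := by gcongr
        _ ≤ (1 + C) * ‖w‖ := by nlinarith [norm_nonneg w]
  -- ### the pointwise package at `z = z₀ + ζ`, `0 < |ζ| < R'`
  have pkg : ∀ ζ : ℂ, ζ ≠ 0 → ‖ζ‖ < R' →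
      let z := z₀ + ζ
      let s := ξ z
      let θ := (SOL s).1
      let η := (SOL s).2
      z ∈ ball z₀ ρ ∧ z ∈ ball z₀ r₁ ∧ z ≠ z₀ ∧ s ≠ 0 ∧ ‖s‖ ≤ 2 * ‖ζ‖ ∧ ‖s‖ < ε₁ ∧ ‖s‖ < ε₂ ∧
      ‖θ‖ ≤ 2 * ‖s‖ ∧ θ ≠ 0 ∧ θ ∈ ball (0 : ℂ) ρ₁ ∧ θ ∈ ball (0 : ℂ) r₂ ∧
      ξ.symm θ ∈ ball z₀ (ρ / 2) ∧ ξ (ξ.symm θ) = θ ∧ ξ.symm θ ≠ z₀ ∧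
      ‖η‖ ≤ (2 * C + 1 / 2) * ‖s‖ ^ (k + 1) ∧
      pt k uhat θ ∈ closedBall (0 : ℂ × ℂ) δ ∧ Θ (u z) ∈ closedBall (0 : ℂ × ℂ) δ ∧
      Θ (u (ξ.symm θ)) = pt k uhat θ ∧ Θ (u z) = pt k uhat θ + X (pt k uhat θ) η ∧
      ContDiffAt ℝ 1 SOL s ∧ DifferentiableAt ℝ SOL s ∧
      ‖fderiv ℝ (fun s' => (SOL s').1) s‖ ≤ B ∧ ‖fderiv ℝ (fun s' => (SOL s').2) s‖ ≤ B ∧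
      C * ‖ξ.symm θ - z₀‖ ≤ k / 128 := by
    intro ζ hζ hζR z s θ η
    have hζr₁ : ‖ζ‖ < r₁ := hζR.trans_le hR'r₁
    have hzr₁ : z ∈ ball z₀ r₁ := by
      rw [mem_ball, dist_eq_norm]; simpa [z] using hζr₁
    have hzρ : z ∈ ball z₀ ρ := ball_subset_ball hr₁ρ hzr₁
    have hzne : z ≠ z₀ := by
      intro h; apply hζ; simpa [z] using congrArg (· - z₀) h
    have hsne : s ≠ 0 := hξne z hzr₁ hzne
    have hs2 : ‖s‖ ≤ 2 * ‖ζ‖ := by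
      have := hξb z hzr₁; simpa [z] using this
    have hsε₁ : ‖s‖ < ε₁ := by
      have : R' ≤ ε₁ / 2 := hR'ε.trans (by gcongr; exact min_le_left _ _)
      linarith
    have hsε₂ : ‖s‖ < ε₂ := by
      have : R' ≤ ε₂ / 2 := hR'ε.trans (by gcongr; exact min_le_right _ _)
      linarith
    obtain ⟨hr1, hrρ, hrδ1, hrδ2, hbox, hfix, -, hη, ⟨heq1, heq2⟩, -, -, -, hsolC1⟩ :=
      hreg s hsne hsε₁
    obtain ⟨hdsol, -, hD1, hD2⟩ := hder s hsne hsε₂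
    obtain ⟨hθup, hθlo, hθρ₁, -, hpmemX, -, -⟩ :=
      box_pointwise (k := k) (εb := εb) (uh := uhat) (X := X) hC hCX huhat1 hX1 hεn hr1 hrρ hrδ1
        hrδ2 hbox
    have hθne : θ ≠ 0 := by
      intro h
      have h' : ‖s‖ / 2 ≤ ‖θ‖ := hθlo
      rw [h, norm_zero] at h'
      exact hsne (norm_le_zero_iff.1 (by linarith [norm_nonneg s]))
    have hθr₂ : θ ∈ ball (0 : ℂ) r₂ := by
      rw [mem_ball_zero_iff]
      calc ‖θ‖ ≤ 2 * ‖s‖ := hθup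
        _ ≤ 2 * (2 * ‖ζ‖) := by gcongr
        _ < 2 * (2 * (r₂ / 4)) := by gcongr; exact hζR.trans_le hR'r₂
        _ = r₂ := by ring
    obtain ⟨hsymmball, hξsymm⟩ := hsball θ hθr₂
    have hsymmρ : ξ.symm θ ∈ ball z₀ ρ := ball_subset_ball (by linarith) hsymmball
    have hsymmne : ξ.symm θ ≠ z₀ := by
      intro h
      apply hθne
      rw [← hξsymm, h, hξ0]
    -- sizes
    have hs1 : ‖s‖ ≤ 1 := by linarith [hζR.trans_le hR'1]
    have hθ1 : ‖θ‖ ≤ 1 := by linarith [hζR.trans_le hR'1]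
    have hC1 : 0 < 1 + C := by linarith
    have hζδ : (1 + C) * (4 * ‖ζ‖) ≤ δ := by
      have h1 : ‖ζ‖ ≤ δ / (4 * (1 + C)) := hζR.le.trans hR'δ
      rw [le_div_iff₀ (by positivity)] at h1
      linarith
    have hptδ : pt k uhat θ ∈ closedBall (0 : ℂ × ℂ) δ := by
      rw [mem_closedBall, dist_zero_right]
      calc ‖pt k uhat θ‖ ≤ (1 + C) * ‖θ‖ := hptbound θ hθρ₁ hθ1
        _ ≤ (1 + C) * (4 * ‖ζ‖) := by gcongr; linarith
        _ ≤ δ := hζδ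
    have hsρ₁ : s ∈ ball (0 : ℂ) ρ₁ := by
      rw [mem_ball_zero_iff]; linarith
    have hgzδ : Θ (u z) ∈ closedBall (0 : ℂ × ℂ) δ := by
      rw [mem_closedBall, dist_zero_right, hnf z hzρ]
      calc ‖(((ξ z) ^ k, uhat (ξ z)) : ℂ × ℂ)‖ = ‖pt k uhat s‖ := rfl
        _ ≤ (1 + C) * ‖s‖ := hptbound s hsρ₁ hs1
        _ ≤ (1 + C) * (4 * ‖ζ‖) := by gcongr; linarith
        _ ≤ δ := hζδ
    obtain ⟨hpt_eq, hpush⟩ := pushoff_identity (X := X) hnf hzρ hsymmρ hξsymm heq1 heq2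
    have hsmall : C * ‖ξ.symm θ - z₀‖ ≤ k / 128 := by
      have h1 : ‖ξ.symm θ - z₀‖ ≤ 2 * ‖θ‖ := hsb θ hθr₂
      have h2 : ‖ζ‖ ≤ k / (1024 * (C + 1)) := hζR.le.trans hR'k
      have h3 : C * ‖ξ.symm θ - z₀‖ ≤ C * (8 * ‖ζ‖) := by
        apply mul_le_mul_of_nonneg_left _ hC
        calc ‖ξ.symm θ - z₀‖ ≤ 2 * ‖θ‖ := h1
          _ ≤ 2 * (2 * ‖s‖) := by gcongr
          _ ≤ 2 * (2 * (2 * ‖ζ‖)) := by gcongr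
          _ = 8 * ‖ζ‖ := by ring
      have h4 : C * (8 * ‖ζ‖) ≤ (C + 1) * (8 * (k / (1024 * (C + 1)))) := by
        have : C * (8 * ‖ζ‖) ≤ (C + 1) * (8 * ‖ζ‖) := by nlinarith [norm_nonneg ζ]
        exact this.trans (by gcongr)
      have h5 : (C + 1) * (8 * (k / (1024 * (C + 1)))) = k / 128 := by
        field_simp; ring
      linarith
    exact ⟨hzρ, hzr₁, hzne, hsne, hs2, hsε₁, hsε₂, hθup, hθne, hθρ₁, hθr₂, hsymmball, hξsymm,
      hsymmne, hη, hptδ, hgzδ, hpt_eq, hpush, hsolC1, hdsol, hD1, hD2, hsmall⟩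
  -- ### the constants of the conclusion
  set C' : ℝ := (2 * C + 1 / 2) * 2 ^ (k + 1) with hC'
  set B' : ℝ := B * 2 with hB'
  set M₀ : ℝ := 5 * (K * 3 * (A₀ * (2 * (B * 2)) + 3 * (B * 2)) + (1 + 2) * L₁ * A₀ * (2 * (B * 2)))
    with hM₀
  have hM₀0 : 0 ≤ M₀ := by positivity
  -- derivative of `f` at `ζ`: chain rule through `ξ`
  have hderivf : ∀ ζ : ℂ, ζ ≠ 0 → ‖ζ‖ < R' →
      HasFDerivAt (fun ζ => (SOL (ξ (z₀ + ζ))).2)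
        ((fderiv ℝ (fun s' => (SOL s').2) (ξ (z₀ + ζ))).comp (fderiv ℝ ξ (z₀ + ζ))) ζ ∧
      ‖(fderiv ℝ (fun s' => (SOL s').2) (ξ (z₀ + ζ))).comp (fderiv ℝ ξ (z₀ + ζ))‖ ≤ B' := by
    intro ζ hζ hζR
    obtain ⟨-, hzr₁, -, -, -, -, -, -, -, -, -, -, -, -, -, -, -, -, -, -, hdsol, -, hD2, -⟩ :=
      pkg ζ hζ hζR
    obtain ⟨hξd, hξn⟩ := hξD (z₀ + ζ) hzr₁
    have h2 : HasFDerivAt (fun s' => (SOL s').2) (fderiv ℝ (fun s' => (SOL s').2) (ξ (z₀ + ζ)))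
        (ξ (z₀ + ζ)) := hdsol.snd.hasFDerivAt
    have hcomp : HasFDerivAt (fun z => (SOL (ξ z)).2)
        ((fderiv ℝ (fun s' => (SOL s').2) (ξ (z₀ + ζ))).comp (fderiv ℝ ξ (z₀ + ζ))) (z₀ + ζ) :=
      h2.comp (z₀ + ζ) hξd.hasFDerivAt
    refine ⟨(hasFDerivAt_comp_add_left z₀).2 hcomp, ?_⟩
    calc ‖(fderiv ℝ (fun s' => (SOL s').2) (ξ (z₀ + ζ))).comp (fderiv ℝ ξ (z₀ + ζ))‖
        ≤ ‖fderiv ℝ (fun s' => (SOL s').2) (ξ (z₀ + ζ))‖ * ‖fderiv ℝ ξ (z₀ + ζ)‖ :=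
          ContinuousLinearMap.opNorm_comp_le _ _
      _ ≤ B * 2 := by gcongr
  refine ⟨R', C', B', M₀ / 2, hR'pos, ?_, ?_, ?_, ?_⟩
  · -- ### `C¹` on the punctured disc
    intro ζ hζ
    obtain ⟨hζb, hζ0⟩ := hζ
    have hζ0' : ζ ≠ 0 := hζ0
    have hζR : ‖ζ‖ < R' := mem_ball_zero_iff.1 hζb
    obtain ⟨hzρ, hzr₁, hzne, -, -, -, -, -, -, -, -, -, -, -, -, -, -, -, -, hsolC1, -⟩ :=
      pkg ζ hζ0' hζR
    have hξat : ContDiffAt ℝ 1 ξ (z₀ + ζ) := by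
      have hmem : z₀ + ζ ∈ ξ.source \ {z₀} := ⟨hsrc hzρ, hzne⟩
      exact ((hξsmooth.of_le (by norm_cast)).contDiffWithinAt hmem).contDiffAt
        ((ξ.open_source.sdiff isClosed_singleton).mem_nhds hmem)
    have hadd : ContDiffAt ℝ 1 (fun ζ : ℂ => z₀ + ζ) ζ := contDiffAt_const.add contDiffAt_id
    have h1 : ContDiffAt ℝ 1 (fun ζ : ℂ => ξ (z₀ + ζ)) ζ := hξat.comp ζ hadd
    have h2 : ContDiffAt ℝ 1 (fun ζ : ℂ => SOL (ξ (z₀ + ζ))) ζ :=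
      hsolC1.comp (f := fun ζ : ℂ => ξ (z₀ + ζ)) ζ h1
    exact h2.snd.contDiffWithinAt
  · -- ### the size bound
    intro ζ hζ
    obtain ⟨hζb, hζ0⟩ := hζ
    have hζR : ‖ζ‖ < R' := mem_ball_zero_iff.1 hζb
    obtain ⟨-, -, -, -, hs2, -, -, -, -, -, -, -, -, -, hη, -⟩ := pkg ζ hζ0 hζR
    calc ‖(SOL (ξ (z₀ + ζ))).2‖ ≤ (2 * C + 1 / 2) * ‖ξ (z₀ + ζ)‖ ^ (k + 1) := hη
      _ ≤ (2 * C + 1 / 2) * (2 * ‖ζ‖) ^ (k + 1) := by gcongr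
      _ = C' * ‖ζ‖ ^ (k + 1) := by rw [hC', mul_pow]; ring
  · -- ### the derivative bound
    intro ζ hζ
    obtain ⟨hζb, hζ0⟩ := hζ
    have hζR : ‖ζ‖ < R' := mem_ball_zero_iff.1 hζb
    obtain ⟨hf, hfb⟩ := hderivf ζ hζ0 hζR
    rw [hf.fderiv]
    exact hfb
  · -- ### the Cauchy–Riemann inequality
    intro ζ hζ
    obtain ⟨hζb, hζ0⟩ := hζ
    have hζ0' : ζ ≠ 0 := hζ0
    have hζR : ‖ζ‖ < R' := mem_ball_zero_iff.1 hζb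
    obtain ⟨hzρ, hzr₁, hzne, hsne, hs2, hsε₁, hsε₂, hθup, hθne, hθρ₁, hθr₂, hsymmball, hξsymm,
      hsymmne, hη, hptδ, hgzδ, hpt_eq, hpush, hsolC1, hdsol, hD1, hD2, hsmall⟩ := pkg ζ hζ0' hζR
    -- names
    set z : ℂ := z₀ + ζ with hz_def
    set s : ℂ := ξ z with hs_def
    set θ : ℂ := (SOL s).1 with hθ_def
    set y : ℂ × ℂ := pt k uhat θ with hy_def
    set φt : ℂ → ℂ := fun z' => ξ.symm (SOL (ξ z')).1 with hφt
    set ηt : ℂ → ℂ := fun z' => (SOL (ξ z')).2 with hηt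
    have hφtz : φt z = ξ.symm θ := rfl
    have hsymmρ : ξ.symm θ ∈ ball z₀ ρ := ball_subset_ball (by linarith) hsymmball
    have hgy : (Θ ∘ u) (φt z) = y := by rw [hφtz]; exact hpt_eq
    have hytgt : y ∈ Θ.target := hδV hptδ
    -- differentiability data
    obtain ⟨hξd, hξn⟩ := hξD z hzr₁
    obtain ⟨hsd, hsn⟩ := hsD θ hθr₂
    have hgζ : DifferentiableAt ℝ (Θ ∘ u) (φt z) := by rw [hφtz]; exact hgd _ hsymmρ
    have hholz : fderiv ℝ (Θ ∘ u) z I = J₂ ((Θ ∘ u) z) (fderiv ℝ (Θ ∘ u) z 1) := hghol z hzρ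
    have hholζ : fderiv ℝ (Θ ∘ u) (φt z) I = J₂ ((Θ ∘ u) (φt z)) (fderiv ℝ (Θ ∘ u) (φt z) 1) := by
      rw [hφtz]; exact hghol _ hsymmρ
    have hJ2y : ∀ v, J₂ ((Θ ∘ u) (φt z)) (J₂ ((Θ ∘ u) (φt z)) v) = -v := by
      rw [hgy]; exact hJ₂2 y hytgt
    have hL : HasFDerivAt X (fderiv ℝ X ((Θ ∘ u) (φt z))) ((Θ ∘ u) (φt z)) := by
      rw [hgy]; exact (hDX y hptδ).1
    have hLI : ∀ w, X ((Θ ∘ u) (φt z)) (I * w) = J₂ ((Θ ∘ u) (φt z)) (X ((Θ ∘ u) (φt z)) w) :=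
      fun w => NormalPushoff.frame_I_mul J₂ hJ2y w
    -- `φ̃` and `η̃`
    have h1 : HasFDerivAt (fun s' => (SOL s').1) (fderiv ℝ (fun s' => (SOL s').1) s) s :=
      hdsol.fst.hasFDerivAt
    have h1z : HasFDerivAt (fun z' => (SOL (ξ z')).1)
        ((fderiv ℝ (fun s' => (SOL s').1) s).comp (fderiv ℝ ξ z)) z := h1.comp z hξd.hasFDerivAt
    set Φ' : ℂ →L[ℝ] ℂ := (fderiv ℝ ξ.symm θ).comp
      ((fderiv ℝ (fun s' => (SOL s').1) s).comp (fderiv ℝ ξ z)) with hΦ'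
    have hφ : HasFDerivAt φt Φ' z := hsd.hasFDerivAt.comp z h1z
    have hΦ'n : ‖Φ'‖ ≤ 2 * (B * 2) := by
      calc ‖Φ'‖ ≤ ‖fderiv ℝ ξ.symm θ‖ * ‖(fderiv ℝ (fun s' => (SOL s').1) s).comp (fderiv ℝ ξ z)‖ :=
            ContinuousLinearMap.opNorm_comp_le _ _
        _ ≤ 2 * (‖fderiv ℝ (fun s' => (SOL s').1) s‖ * ‖fderiv ℝ ξ z‖) := by
            gcongr; exact ContinuousLinearMap.opNorm_comp_le _ _
        _ ≤ 2 * (B * 2) := by gcongr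
    set N' : ℂ →L[ℝ] ℂ := (fderiv ℝ (fun s' => (SOL s').2) s).comp (fderiv ℝ ξ z) with hN'
    have hη' : HasFDerivAt ηt N' z := (hdsol.snd.hasFDerivAt).comp z hξd.hasFDerivAt
    have hN'n : ‖N'‖ ≤ B * 2 :=
      (ContinuousLinearMap.opNorm_comp_le _ _).trans (by gcongr)
    -- the push-off identity near `z`
    have hid : ∀ᶠ z' in 𝓝 z, (Θ ∘ u) z' = (Θ ∘ u) (φt z') + X ((Θ ∘ u) (φt z')) (ηt z') := by
      have hopen : IsOpen (ball z₀ R' \ {z₀}) := isOpen_ball.sdiff isClosed_singleton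
      have hzmem : z ∈ ball z₀ R' \ {z₀} := by
        refine ⟨?_, hzne⟩
        rw [mem_ball, dist_eq_norm]; simpa [hz_def] using hζR
      filter_upwards [hopen.mem_nhds hzmem] with z' hz'
      obtain ⟨hz'b, hz'ne⟩ := hz'
      set ζ' : ℂ := z' - z₀ with hζ'
      have hζ'ne : ζ' ≠ 0 := sub_ne_zero.2 hz'ne
      have hζ'R : ‖ζ'‖ < R' := by rwa [mem_ball, dist_eq_norm] at hz'b
      have hz'eq : z₀ + ζ' = z' := by rw [hζ']; abel
      obtain ⟨-, -, -, -, -, -, -, -, -, -, -, -, -, -, -, -, -, hpt', hpush', -⟩ := pkg ζ' hζ'ne hζ'R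
      rw [hz'eq] at hpt' hpush'
      show Θ (u z') = Θ (u (ξ.symm (SOL (ξ z')).1)) + X (Θ (u (ξ.symm (SOL (ξ z')).1))) (SOL (ξ z')).2
      rw [hpt', hpush']
    -- the projector
    obtain ⟨htne, c, hc, hdir⟩ : fderiv ℝ (Θ ∘ u) (φt z) 1 ≠ 0 ∧ ∃ c : ℂ, ‖c‖ = 1 ∧
        ‖(‖fderiv ℝ (Θ ∘ u) (φt z) 1‖⁻¹ : ℝ) • fderiv ℝ (Θ ∘ u) (φt z) 1 - c • e₁‖ ≤ 1 / 32 := by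
      have hζ'mem : ξ.symm θ - z₀ ∈ ball (0 : ℂ) ρ := by
        rw [mem_ball_zero_iff]
        have : ξ.symm θ ∈ ball z₀ ρ := hsymmρ
        rwa [mem_ball, dist_eq_norm] at this
      have hhd : DifferentiableAt ℝ (fun z => Θ (u (z₀ + z))) (ξ.symm θ - z₀) := by
        have := hgd _ hsymmρ
        have heq : z₀ + (ξ.symm θ - z₀) = ξ.symm θ := by abel
        exact (differentiableAt_comp_add_left (f := Θ ∘ u) z₀).2 (by rw [heq]; exact this)
      have hfd : fderiv ℝ (fun z => Θ (u (z₀ + z))) (ξ.symm θ - z₀) = fderiv ℝ (Θ ∘ u) (φt z) := by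
        rw [hφtz]
        have := fderiv_comp_add_left (𝕜 := ℝ) (f := Θ ∘ u) z₀ (x := ξ.symm θ - z₀)
        have heq : z₀ + (ξ.symm θ - z₀) = ξ.symm θ := by abel
        rw [heq] at this
        exact this
      have ht := tangent_direction (h := fun z => Θ (u (z₀ + z))) hk' (sub_ne_zero.2 hsymmne) hhd
        (hb2 _ hζ'mem) hsmall
      rw [hfd] at ht
      exact ht
    have hJi : ‖J₂ y - I • ContinuousLinearMap.id ℝ (ℂ × ℂ)‖ ≤ 1 / 8 := hnear y hptδ
    obtain ⟨-, hdet, hPn⟩ := norm_proj_le_of_near (J := J₂ y) hJi htne hc hdir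
    set P : ℂ × ℂ →L[ℝ] ℂ := proj (J₂ y) (fderiv ℝ (Θ ∘ u) (φt z) 1) with hP
    have hP1 : ∀ c, P (fderiv ℝ (Θ ∘ u) (φt z) c) = 0 := by
      intro c
      have hA : fderiv ℝ (Θ ∘ u) (φt z) I = J₂ y (fderiv ℝ (Θ ∘ u) (φt z) 1) := by rw [← hgy]; exact hholζ
      exact proj_apply_of_holomorphic (hJ₂2 y hytgt) hA c
    have hP2 : ∀ w, P (X ((Θ ∘ u) (φt z)) w) = w := by
      intro w
      rw [hgy]
      exact proj_normalFrame (Jt := J₂) (hJ₂2 y hytgt) hdet w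
    -- Lipschitz comparison of `J₂` between the two points
    have hKxy : ‖J₂ ((Θ ∘ u) z) - J₂ ((Θ ∘ u) (φt z))‖ ≤ K * ‖(Θ ∘ u) z - (Θ ∘ u) (φt z)‖ := by
      rw [hgy]; exact hLip _ hgzδ _ hptδ
    -- Prop. B.28
    have hmain := NormalPushoff.norm_dbar_le_of_pushoff (Jt := J₂) (g := Θ ∘ u) (L := X) (P := P)
      hgζ hholz hholζ hJ2y hL hLI hφ hη' hid hP1 hP2 hK0 hKxy
    -- bounding the factors
    have hAn : ‖fderiv ℝ (Θ ∘ u) (φt z)‖ ≤ A₀ := by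
      refine hA₀ _ ?_
      rw [hφtz, mem_closedBall, dist_eq_norm]
      have : ξ.symm θ ∈ ball z₀ (ρ / 2) := hsymmball
      rw [mem_ball, dist_eq_norm] at this
      exact this.le
    have hXy : ‖X ((Θ ∘ u) (φt z))‖ ≤ 3 := by rw [hgy]; exact hXn y hptδ
    have hL'n : ‖fderiv ℝ X ((Θ ∘ u) (φt z))‖ ≤ L₁ := by rw [hgy]; exact (hDX y hptδ).2
    have hJz : ‖J₂ ((Θ ∘ u) z)‖ ≤ 2 := hJn _ hgzδ
    have hfac : ‖P‖ * (K * ‖X ((Θ ∘ u) (φt z))‖ *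
          (‖fderiv ℝ (Θ ∘ u) (φt z)‖ * ‖Φ'‖ + ‖X ((Θ ∘ u) (φt z))‖ * ‖N'‖) +
        (1 + ‖J₂ ((Θ ∘ u) z)‖) * ‖fderiv ℝ X ((Θ ∘ u) (φt z))‖ * ‖fderiv ℝ (Θ ∘ u) (φt z)‖ * ‖Φ'‖)
        ≤ M₀ := by
      rw [hM₀]
      gcongr
    have hineq : ‖N' 1 + I * N' I‖ ≤ M₀ * ‖ηt z‖ :=
      hmain.trans (mul_le_mul_of_nonneg_right hfac (norm_nonneg _))
    -- translate to `dbarAlong 1 f ζ`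
    obtain ⟨hf, -⟩ := hderivf ζ hζ0' hζR
    have hfd' : fderiv ℝ (fun ζ => (SOL (ξ (z₀ + ζ))).2) ζ = N' := hf.fderiv
    rw [dbarAlong_apply, hfd']
    have : ‖(2 : ℂ)⁻¹ • (N' 1 + I • N' (I • (1 : ℂ)))‖ = 2⁻¹ * ‖N' 1 + I * N' I‖ := by
      rw [norm_smul, norm_inv, Complex.norm_two, smul_eq_mul, smul_eq_mul, mul_one]
    rw [this]
    calc 2⁻¹ * ‖N' 1 + I * N' I‖ ≤ 2⁻¹ * (M₀ * ‖ηt z‖) := by gcongr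
      _ = M₀ / 2 * ‖(SOL (ξ (z₀ + ζ))).2‖ := by rw [hηt]; ring

end Literature.Geometry.Symplectic.RotationBranch

end
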